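import Summits.CriticalPhenomena.Ising3DConformalLimit.Theorems.TwinThreshold.Negative.TwinThresholdSeamZeroDisorder
import HarnessLib

/-!
# Disproof work file — crux `TwinThreshold` (stmt-CriticalPhenomena-16906, route `ReflectionTwin`, line `seam_renewal`)

Standing crux disprover, cycle 1 (refuter-cdisprove-stmt-CriticalPhenomena-16906-0, 2026-08-17).
VERDICT OF THE CYCLE: **no kill.** The crux is the lattice shadow of the established defect-RG phase diagram of a
symmetric plane defect in the 3D Ising class; every route to `¬ TwinThreshold` needs either `Δ̂_ord ≤ 1` (against
`Δ̂_ord = 1.2751(6)`) or a first-order onset of plane order inside a critical n.n. ferromagnetic bulk (no mechanism), and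
the formal statement has no junk (audited symbol by symbol, §0); the MC `J`-scan of the typed twin (§6) shows one smooth threshold
at `J* = 1.0 ± 0.15`. What IS landed: the load-bearing structure (§2).

Index
* §0 `twinThreshold_iff` — the crux over closed terms (`Iff.rfl`); formal audit in the docstring of `cplC`.
* §1 GAUGE LEMMA `gibbsAvg_flipBy` — flipping the spins on `{ε = -1}` = gauging the couplings (exact). LANDED as
  `Literature.Probability.LatticeModels.PairIsing.gibbsAvg_gauge` (p167349, `Theorems/TwinThreshold/Negative/TwinThresholdSeamEvenness.lean`).
* §2 LOAD-BEARING STRUCTURE OF THE CRUX (all sorry-free; LANDED in p167349 in ζβ-reduced currency):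
  - `twinLatC_neg_plane` / `lroC_neg_iff`: every bond of the twin has AT MOST ONE endpoint on the plane, so the plane gauge
    sends `TW(J) ↦ TW(-J)`: plane two-point function and `LRO` are EVEN in `J`; the `LRO`-set of a threshold is
    `(-∞,-J*) ∪ (J*,∞)` (`lroC_of_lt_neg_of_threshold`).
  - `not_lroC_of_monoAll` / `not_twinThreshold_of_monoAll`: stub (M) with its guard `0 ≤ J` deleted forces plane DISORDER
    AT EVERY COUPLING and contradicts the crux — the guard is load-bearing (any proof of (M) must use `0 ≤ J`).
  - `twinLatC_zero_of_ne` / `not_lroC_zero` (= the tree's `twinLat_zero_two_eq_zero` / `not_LRO_zero`,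
    `Negative/TwinThresholdSeamZeroDisorder.lean`, USED here by `exact`): `J = 0` is plane-disordered; hence
    `nonneg_of_threshold` (free) and `pos_of_threshold_of_weakDisorder`: the conjunct `0 < J` is load-bearing exactly
    through (W) `∃ J > 0, ¬ LRO J`.
* §2b (LANDED p169504, `Negative/TwinThresholdBubbleGuards.lean`): both guards of the open stub (C2) are load-bearing —
  `stub_bubbleIntegrable_false_without_disorderGuard`, `stub_bubbleIntegrable_false_without_nonnegGuard` (see §4).
* §3 WHY THE CRUX RESISTS — census of attacks (module doc below).
* §4 `-- Line seam_renewal` — stub-by-stub audit: 4 of 6 stubs LANDED by the lead ((M) p166260, (S) p168573, (W2) p169014,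
  (C′) p167917); OPEN (W1), (C2) — both physically true, no stub refuted; BOTH GUARDS of (C2) are load-bearing, LANDED as
  theorems (p169504, `Negative/TwinThresholdBubbleGuards.lean`); (C2)'s true margin recomputed (integrable blow-up allowed:
  `Δ̂_onset > (2-y)/4 = 0.35`, not `η > 0`); joint sufficiency `(W1) → (C2) → TwinThreshold` kernel-checked by the lead.
* §5 NEAR-MISSES (the only `sorry`s of this file): parameter variants that WOULD be false — supercritical bulk (`J* = 0`)
  and all-sites order — with the exact missing tree input named.
* §6 NUMERICS — MC `J`-scan of the typed twin (kit job j026694, done): Binder crossings put `J* = 1.0 ± 0.15`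
  (finite, positive; the untuned twin `J = 1` sits at the threshold within resolution), plane susceptibility saturates in
  `L` for `J ≤ 0.9`, free-box corner correlator bounded below for `J ≥ 1.35`, no first-order signature — corroborates the crux.

Everything outside `section NearMisses` is sorry-free.
-/

noncomputable section

namespace Summit.CriticalPhenomena.Ising3DConformalLimit.Cruxes.TwinThreshold.Disproof

open scoped BigOperators
open Literature.Probability.LatticeModels
open Summit.CriticalPhenomena.Ising3DConformalLimit.Theses

/-! ## §0 The crux over closed terms -/

/-- The box coupling matrix of the (111) reflection twin `TW(J)` at bulk `β_c(3)` (ordered pairs; the crux's `cpl`, verbatim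
after ζβ-reduction of its `let`-chain).

FORMAL AUDIT of the crux (symbol by symbol, no finding): `gibbsWeight c s = exp(∑_a∑_b c a b σ_aσ_b)` sums ORDERED pairs, so
the factor `criticalBeta 3 / 2` gives every bond the weight `β_c(3)·w` (`w = J` on the six bonds at each plane site — three
regular ones to layer `-1`, three seam bonds `{c, eᵢ - c}` to layer `1` — and `w = 1` elsewhere); `Adj a a` is false; no two
plane sites are adjacent (`not_both_plane_of_adj`), so "`hZ a = 0 ∨ hZ b = 0`" means "exactly one endpoint on the plane";
`box 3 L = {-L,…,L}³` (free b.c.), the observable is `0` when a point leaves the box and `|gibbsAvg| ≤ 1` otherwise, so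
`⨆ L` ranges over a bounded set (no `sSup` junk) and, for `J ≥ 0`, equals the `L → ∞` limit by Griffiths II;
`criticalBeta 3 = sInf {β ≥ 0 | m*(β) > 0}` with `criticalBeta_pos_holds` in tree (so `cpl ≢ 0`); the quantifier order
`∃ J, 0 < J ∧ ¬ LRO J ∧ ∀ J' > J, LRO J'` matches the informal "continuous, strictly positive threshold"; `LRO` quantifies
over plane sites only and includes `c = 0` (value `1`, harmless); in-plane homogeneity of `TW(J)` holds through
`φ_t : z ↦ z + t` (`h z ≤ 0`), `z ↦ z - t` (`h z ≥ 1`) for `h t = 0`, so basing `LRO` at the origin loses nothing.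
Smells checked and absent: ℕ-subtraction, division by a possibly-zero quantity (only `/2`), `Finset.sup ∅`, unbounded
`tsum`/`sSup`, hidden `[Fintype]`, coercion order (`|a i - b i|` is in `ℤ`). [folklore] -/
def cplC (J : ℝ) (L : ℕ) (a b : ↥(box 3 L)) : ℝ :=
  if (((∑ i, |a.1 i - b.1 i| = 1) ∧ ¬ ((a.1 0 + a.1 1 + a.1 2 = 0 ∧ b.1 0 + b.1 1 + b.1 2 = 1) ∨ (a.1 0 + a.1 1 + a.1 2 = 1 ∧ b.1 0 + b.1 1 + b.1 2 = 0))) ∨ (((a.1 0 + a.1 1 + a.1 2 = 0 ∧ b.1 0 + b.1 1 + b.1 2 = 1) ∨ (a.1 0 + a.1 1 + a.1 2 = 1 ∧ b.1 0 + b.1 1 + b.1 2 = 0)) ∧ ∃ i : Fin 3, a.1 + b.1 = Pi.single i 1)) then (criticalBeta 3 / 2) * (if a.1 0 + a.1 1 + a.1 2 = 0 ∨ b.1 0 + b.1 1 + b.1 2 = 0 then J else 1) else 0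

/-- The box observable `∏ᵢ σ_{zᵢ}` (zero if some `zᵢ` is outside the box), verbatim from the crux. [folklore] -/
def obsC (L : ℕ) (k : ℕ) (z : Fin k → Site 3) : SpinConfig ↥(box 3 L) → ℝ :=
  fun s => ∏ i, if h : z i ∈ box 3 L then spinAt (⟨z i, h⟩ : ↥(box 3 L)) s else 0

/-- The sup-over-boxes free twin correlator (the crux's `twinLat`), as ONE closed term (verbatim copy of
`Lines/seam_renewal.lean:twinLatC`). [folklore] -/
def twinLatC : ℝ → (k : ℕ) → (Fin k → Site 3) → ℝ := (fun (J : ℝ) (k : ℕ) (z : Fin k → Site 3) => ⨆ L : ℕ, PairIsing.gibbsAvg (fun a b : ↥(box 3 L) => if (((∑ i, |a.1 i - b.1 i| = 1) ∧ ¬ ((a.1 0 + a.1 1 + a.1 2 = 0 ∧ b.1 0 + b.1 1 + b.1 2 = 1) ∨ (a.1 0 + a.1 1 + a.1 2 = 1 ∧ b.1 0 + b.1 1 + b.1 2 = 0))) ∨ (((a.1 0 + a.1 1 + a.1 2 = 0 ∧ b.1 0 + b.1 1 + b.1 2 = 1) ∨ (a.1 0 + a.1 1 + a.1 2 = 1 ∧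 b.1 0 + b.1 1 + b.1 2 = 0)) ∧ ∃ i : Fin 3, a.1 + b.1 = Pi.single i 1)) then (criticalBeta 3 / 2) * (if a.1 0 + a.1 1 + a.1 2 = 0 ∨ b.1 0 + b.1 1 + b.1 2 = 0 then J else 1) else 0) (fun s => ∏ i, if h : z i ∈ box 3 L then spinAt (⟨z i, h⟩ : ↥(box 3 L)) s else 0))

/-- Plane long-range order of `TW(J)` (the crux's `LRO`). [folklore] -/
def lroC (J : ℝ) : Prop := ∃ m : ℝ, 0 < m ∧ ∀ c : Site 3, c 0 + c 1 + c 2 = 0 → m ≤ twinLatC J 2 ![0, c]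

/-- `twinLatC` through the named coupling matrix and observable (definitional). [folklore] -/
theorem twinLatC_eq (J : ℝ) (k : ℕ) (z : Fin k → Site 3) :
    twinLatC J k z = ⨆ L : ℕ, PairIsing.gibbsAvg (cplC J L) (obsC L k z) := rfl

/-- The crux, read through the closed terms: a strictly positive seam coupling without plane LRO above which every coupling
has plane LRO (pure unfolding). [folklore] -/
theorem twinThreshold_iff :
    ReflectionTwin.TwinThreshold ↔ ∃ J : ℝ, 0 < J ∧ ¬ lroC J ∧ ∀ J' : ℝ, J < J' → lroC J' := Iff.rfl

/-! ## §1 Gauge (spin-flip) transport of a finite pair-coupling Gibbs average -/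

section Gauge

variable {ι : Type*} [Fintype ι] [DecidableEq ι]

/-- Flipping the spins by a sign pattern `ε : ι → ℤˣ` (an involution of the configuration space). [folklore] -/
def flipBy (ε : ι → ℤˣ) : SpinConfig ι ≃ SpinConfig ι where
  toFun s a := ε a * s a
  invFun s a := ε a * s a
  left_inv s := by
    funext a
    show ε a * (ε a * s a) = s a
    rw [← mul_assoc, Int.units_mul_self, one_mul]
  right_inv s := by
    funext a
    show ε a * (ε a * s a) = s a
    rw [← mul_assoc, Int.units_mul_self, one_mul]

omit [Fintype ι] [DecidableEq ι] in
theorem spinAt_flipBy (ε : ι → ℤˣ) (s : SpinConfig ι) (a : ι) :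
    spinAt a (flipBy ε s) = ((ε a : ℤ) : ℝ) * spinAt a s := by
  simp [spinAt, flipBy, Units.val_mul, Int.cast_mul]

omit [DecidableEq ι] in
/-- The Boltzmann weight of a flipped configuration is the weight of the original one for the gauged couplings
`ε_a ε_b c_{ab}`. [folklore] -/
theorem gibbsWeight_flipBy (ε : ι → ℤˣ) (c : ι → ι → ℝ) (s : SpinConfig ι) :
    PairIsing.gibbsWeight c (flipBy ε s) =
      PairIsing.gibbsWeight (fun a b => ((ε a : ℤ) : ℝ) * ((ε b : ℤ) : ℝ) * c a b) s := by
  simp only [PairIsing.gibbsWeight, spinAt_flipBy]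
  congr 1
  refine Finset.sum_congr rfl fun a _ => Finset.sum_congr rfl fun b _ => ?_
  ring

/-- **Gauge transport.** `⟨f⟩_c = ⟨f ∘ flip_ε⟩_{ε ε c}`: reindex both sums of the Gibbs average by the involution `flip_ε`.
[folklore] -/
theorem gibbsAvg_flipBy (ε : ι → ℤˣ) (c : ι → ι → ℝ) (f : SpinConfig ι → ℝ) :
    PairIsing.gibbsAvg c f =
      PairIsing.gibbsAvg (fun a b => ((ε a : ℤ) : ℝ) * ((ε b : ℤ) : ℝ) * c a b) (fun s => f (flipBy ε s)) := by
  simp only [PairIsing.gibbsAvg]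
  rw [← Equiv.sum_comp (flipBy ε) (fun ρ => f ρ * PairIsing.gibbsWeight c ρ),
    ← Equiv.sum_comp (flipBy ε) (fun ρ => PairIsing.gibbsWeight c ρ)]
  simp only [gibbsWeight_flipBy]

end Gauge

/-! ## §2 Load-bearing structure: evenness in `J`, disorder at `J = 0`, the sign guard of (M) -/

/-- No bond of the twin joins two plane sites: the first adjacency clause (`ℓ¹`-distance 1) changes the height
`h = z₀+z₁+z₂` by `±1` (parity), the second one joins heights `0` and `1`. [folklore] -/
theorem not_both_plane_of_adj {a b : Site 3}
    (hadj : ((∑ i, |a i - b i| = 1) ∧ ¬ ((a 0 + a 1 + a 2 = 0 ∧ b 0 + b 1 + b 2 = 1) ∨ (a 0 + a 1 + a 2 = 1 ∧ b 0 + b 1 + b 2 = 0))) ∨ (((a 0 + a 1 + a 2 = 0 ∧ b 0 + b 1 + b 2 = 1) ∨ (a 0 + a 1 + a 2 = 1 ∧ b 0 + b 1 + b 2 = 0)) ∧ ∃ i : Fin 3, a + b = Pi.single i 1)) :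
    ¬ (a 0 + a 1 + a 2 = 0 ∧ b 0 + b 1 + b 2 = 0) := by
  rintro ⟨ha, hb⟩
  rcases hadj with ⟨hsum, -⟩ | ⟨hh, -⟩
  · rw [Fin.sum_univ_three] at hsum
    rcases abs_cases (a 0 - b 0) with ⟨h0, _⟩ | ⟨h0, _⟩ <;>
    rcases abs_cases (a 1 - b 1) with ⟨h1, _⟩ | ⟨h1, _⟩ <;>
    rcases abs_cases (a 2 - b 2) with ⟨h2, _⟩ | ⟨h2, _⟩ <;>
    omega
  · omega

/-- The plane sign pattern: `-1` on the plane `h = 0`, `+1` off it. [folklore] -/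
def planeSign (L : ℕ) (a : ↥(box 3 L)) : ℤˣ := if a.1 0 + a.1 1 + a.1 2 = 0 then -1 else 1

theorem planeSign_cast (L : ℕ) (a : ↥(box 3 L)) :
    (((planeSign L a : ℤˣ) : ℤ) : ℝ) = if a.1 0 + a.1 1 + a.1 2 = 0 then -1 else 1 := by
  unfold planeSign; split_ifs <;> simp

/-- **Gauging the plane flips the sign of the seam coupling**: every bond carrying `J` has exactly one endpoint on the plane,
every other bond none. [folklore] -/
theorem cplC_planeGauge (J : ℝ) (L : ℕ) (a b : ↥(box 3 L)) :
    (((planeSign L a : ℤˣ) : ℤ) : ℝ) * (((planeSign L b : ℤˣ) : ℤ) : ℝ) * cplC J L a b = cplC (-J) L a b := by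
  rw [planeSign_cast, planeSign_cast]
  unfold cplC
  by_cases hadj : (((∑ i, |a.1 i - b.1 i| = 1) ∧ ¬ ((a.1 0 + a.1 1 + a.1 2 = 0 ∧ b.1 0 + b.1 1 + b.1 2 = 1) ∨ (a.1 0 + a.1 1 + a.1 2 = 1 ∧ b.1 0 + b.1 1 + b.1 2 = 0))) ∨ (((a.1 0 + a.1 1 + a.1 2 = 0 ∧ b.1 0 + b.1 1 + b.1 2 = 1) ∨ (a.1 0 + a.1 1 + a.1 2 = 1 ∧ b.1 0 + b.1 1 + b.1 2 = 0)) ∧ ∃ i : Fin 3, a.1 + b.1 = Pi.single i 1))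
  · have hnb := not_both_plane_of_adj hadj
    rw [if_pos hadj, if_pos hadj]
    by_cases ha : a.1 0 + a.1 1 + a.1 2 = 0
    · have hb : ¬ b.1 0 + b.1 1 + b.1 2 = 0 := fun hb => hnb ⟨ha, hb⟩
      simp [ha, hb]
    · by_cases hb : b.1 0 + b.1 1 + b.1 2 = 0
      · simp [ha, hb]
      · simp [ha, hb]
  · rw [if_neg hadj, if_neg hadj]
    ring

/-- The plane observable `σ₀σ_c` (`c` on the plane) is invariant under the plane gauge (two sign flips). [folklore] -/
theorem obsC_planeGauge (L : ℕ) (c : Site 3) (hc : c 0 + c 1 + c 2 = 0) (s : SpinConfig ↥(box 3 L)) :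
    obsC L 2 ![0, c] (flipBy (planeSign L) s) = obsC L 2 ![0, c] s := by
  simp only [obsC, Fin.prod_univ_two, Matrix.cons_val_zero, Matrix.cons_val_one]
  have h0 : ((0 : Site 3) 0 + (0 : Site 3) 1 + (0 : Site 3) 2 = 0) := by simp
  split_ifs with hz hc'
  · rw [spinAt_flipBy, spinAt_flipBy, planeSign_cast, planeSign_cast, if_pos h0, if_pos hc]
    ring
  · simp
  · simp
  · simp

/-- **Evenness in the seam coupling.** For every plane site `c`, the box two-point function of `TW(-J)` equals that of
`TW(J)`, box by box; hence so do the sups over boxes. [folklore] -/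
theorem twinLatC_neg_plane (J : ℝ) (c : Site 3) (hc : c 0 + c 1 + c 2 = 0) :
    twinLatC (-J) 2 ![0, c] = twinLatC J 2 ![0, c] := by
  rw [twinLatC_eq, twinLatC_eq]
  refine iSup_congr fun L => ?_
  rw [gibbsAvg_flipBy (planeSign L) (cplC J L)]
  have hcpl : (fun a b => (((planeSign L a : ℤˣ) : ℤ) : ℝ) * (((planeSign L b : ℤˣ) : ℤ) : ℝ) * cplC J L a b) = cplC (-J) L := by
    funext a b; exact cplC_planeGauge J L a b
  have hobs : (fun s => obsC L 2 ![0, c] (flipBy (planeSign L) s)) = obsC L 2 ![0, c] := by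
    funext s; exact obsC_planeGauge L c hc s
  rw [hcpl, hobs]

/-- Plane long-range order is even in `J`. [folklore] -/
theorem lroC_neg_iff (J : ℝ) : lroC (-J) ↔ lroC J := by
  unfold lroC
  constructor
  · rintro ⟨m, hm, h⟩
    exact ⟨m, hm, fun c hc => by rw [← twinLatC_neg_plane J c hc]; exact h c hc⟩
  · rintro ⟨m, hm, h⟩
    exact ⟨m, hm, fun c hc => by rw [twinLatC_neg_plane J c hc]; exact h c hc⟩

/-- Consequence for the crux's threshold: a seam threshold `J*` orders the plane at every strongly ANTIferromagnetic seam
coupling `J' < -J*` as well — the `LRO`-set is the symmetric `(-∞,-J*) ∪ (J*,∞)`, so no statement monotone on all of `ℝ` can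
hold. [folklore] -/
theorem lroC_of_lt_neg_of_threshold {J J' : ℝ} (hthr : ∀ J'' : ℝ, J < J'' → lroC J'') (hJ' : J' < -J) : lroC J' := by
  have h := hthr (-J') (by linarith)
  rwa [lroC_neg_iff] at h

/-- **At `J = 0` the origin is an isolated site** — the tree's `J = 0` anchor, USED verbatim: `⟨σ₀σ_c⟩_{TW(0),L} = 0`
for `c ≠ 0` and every box (single-site spin flip), in closed-term currency by `exact` (definitional agreement checked).
[cite: tree Summit.CriticalPhenomena.Ising3DConformalLimit.Theorems.TwinThreshold.Negative.twinLat_zero_two_eq_zero] -/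
theorem twinLatC_zero_of_ne (c : Site 3) (hc : c ≠ 0) : twinLatC 0 2 ![0, c] = 0 :=
  Summit.CriticalPhenomena.Ising3DConformalLimit.Theorems.TwinThreshold.Negative.twinLat_zero_two_eq_zero c hc

/-- **`J = 0` is plane-disordered** — the tree's `not_LRO_zero`, in closed-term currency. [folklore] -/
theorem not_lroC_zero : ¬ lroC 0 :=
  Summit.CriticalPhenomena.Ising3DConformalLimit.Theorems.TwinThreshold.Negative.not_LRO_zero

/-- `0 < J` in `IsSeamThreshold` is implied by its other two conjuncts as soon as SOME positive coupling is disordered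
(i.e. unless `J* = 0`): the conjunct is load-bearing exactly through (W) `∃ J > 0, ¬ LRO J`. [folklore] -/
theorem pos_of_threshold_of_weakDisorder {J : ℝ} (hthr : ∀ J' : ℝ, J < J' → lroC J')
    (hW : ∃ J₀ : ℝ, 0 < J₀ ∧ ¬ lroC J₀) : 0 < J := by
  obtain ⟨J₀, hJ₀, hdis⟩ := hW
  by_contra hle
  exact hdis (hthr J₀ (by linarith [not_lt.mp hle]))

/-- Without (W) one still gets `0 ≤ J` for free, from `not_lroC_zero`. [folklore] -/
theorem nonneg_of_threshold {J : ℝ} (hthr : ∀ J' : ℝ, J < J' → lroC J') : 0 ≤ J := by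
  by_contra hlt
  exact not_lroC_zero (hthr 0 (not_le.mp hlt))

/-- The UNGUARDED monotonicity in the seam coupling: stub (M) `stub_seamMonotone` of `Lines/seam_renewal.lean` with its
hypothesis `0 ≤ J` deleted. [folklore] -/
def MonoAll : Prop := ∀ J J' : ℝ, J ≤ J' → ∀ c : Site 3, twinLatC J 2 ![0, c] ≤ twinLatC J' 2 ![0, c]

/-- **Unguarded monotonicity forces plane disorder at EVERY coupling**: by evenness and `⟨σ₀σ_c⟩_{J=0} = 0`,
`G_J(0,c) = G_{-|J|}(0,c) ≤ G_0(0,c) = 0` for every plane `c ≠ 0`. [folklore] -/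
theorem not_lroC_of_monoAll (hM : MonoAll) (J : ℝ) : ¬ lroC J := by
  rintro ⟨m, hm, h⟩
  have hc : (![1, -1, 0] : Site 3) 0 + (![1, -1, 0] : Site 3) 1 + (![1, -1, 0] : Site 3) 2 = 0 := by simp
  have hne : (![1, -1, 0] : Site 3) ≠ 0 := by
    intro h0; have := congrFun h0 0; simp at this
  have h1 := h _ hc
  have hz := twinLatC_zero_of_ne _ hne
  rcases le_or_gt 0 J with hJ | hJ
  · have h2 := hM (-J) 0 (by linarith) ![1, -1, 0]
    rw [twinLatC_neg_plane J _ hc, hz] at h2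
    linarith
  · have h2 := hM J 0 hJ.le ![1, -1, 0]
    rw [hz] at h2
    linarith

/-- **The sign guard of (M) is load-bearing**: the unguarded monotonicity is inconsistent with the crux itself (it empties the
set of couplings with plane order, so no `J` has `∀ J' > J, LRO J'`). NOT a refutation and NOT a "negative lemma modulo H":
`MonoAll` is false (it contradicts stub (S), order at strong seam); this theorem only certifies that any proof of (M) must use
`0 ≤ J`. [folklore] -/
theorem not_twinThreshold_of_monoAll (hM : MonoAll) : ¬ ReflectionTwin.TwinThreshold := by
  rw [twinThreshold_iff]
  rintro ⟨J, -, -, hthr⟩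
  exact not_lroC_of_monoAll hM (J + 1) (hthr (J + 1) (by linarith))

/-! ## §3 Why the crux resists — census of attacks (cycle 1; no kill)

1. FORMAL JUNK HUNT (coercions, the `/2` convention, boundedness of `⨆`, symmetry of `Adj`, the seam rule, plane adjacency,
   the junk value of `criticalBeta`) → nothing (audit in the docstring of `cplC`).
2. DEGENERATE PARAMETERS: `J = 0` (isolated plane spins: `¬ LRO 0`, consistent); `J < 0` (EVEN: mirror image, §2);
   `J → ∞` (plane + layers `±1` lock; the seam bilayer `⊂ TW(J)` alone orders — star–triangle to the triangular lattice
   with coupling `2K'`, `e^{4K'} = cosh 3K / cosh K`, `K = β_c(3)J`: order for `J > 0.4157/0.22165 ≈ 1.88` (exact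
   triangular point) resp. `J > 2.55` through a `ℤ²` sublattice) → all consistent with the crux (`J* < ∞`).
3. THE SOLVED SIBLING `d = 2` (seam LINE of the reflection twin of critical `ℤ²`): there `J* = ∞` (marginal
   Bariev/McCoy–Perk defect line, boundary spin dimension `Δ̂ = 1/2 = (d-1)/2`); the killing mechanism is
   `Δ̂_ord ≤ (d-1)/2`, and in `d = 3` `Δ̂_ord - 1 = +0.275(1)` — the counterexample does not transfer.
4. `J* = 0` (plane order at every `J > 0`) needs the inter-face coupling `σ̂σ̂` RELEVANT at the `Ord × Ord` interface:
   `Δ_{σ̂σ̂} = 2Δ̂_ord ≈ 2.55 > 2`, irrelevant (arXiv:2411.16522 p. 7, quoting MC `Δ̂_ord = 1.2751(6)`; KrishnanMetlitski2023 §1;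
   Pleimling 2004 review §2: `γ₁₁ = ν(d-1-2x₁) < 0`, finite surface susceptibility) → not constructible.
5. FIRST-ORDER ONSET: would need a discontinuity fixed point for a `ℤ₂ × θ`-symmetric plane defect of the 3D Ising class;
   defect RG at the transparent point has ONE relevant even coupling (`y = 2 - Δ_ε = 0.587`), `m_C ~ (J-J*)^{Δ_σ/y} ≈ (J-J*)^{0.88}`
   continuous; the catalogued first-order mechanisms (`RandomClusterFirstOrder*`, large `q`) are out of scope at `q = 2`.
   Moreover (REMARK FOR THE LEAD) the crux's `¬ LRO J*` is stated for the FREE state and `J ↦ sup_L ⟨σ₀σ_c⟩_{TW(J),L}` is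
   LEFT-continuous (sup of continuous non-decreasing box averages), so a Potts-like first-order onset (free state disordered
   AT `J*`, finite correlation length from below) would still satisfy the crux; only a 'Thouless' scenario (free state at
   `J*` already ordered while every `J < J*` is disordered, i.e. `G_J(0,c) ⪆ m²` out to a scale `ξ(J) → ∞`) violates (C).
   (C) is thus WEAKER than thermodynamic continuity of the plane magnetisation, and stub (C2)'s integrable bubble is
   precisely a quantitative exclusion of the Thouless scenario.
6. BARRIER CATALOGUE (`Literature/Barriers/CriticalPhenomena/`): `RigorousRGSmallParameter*` bites PROOFS of (W1)/(C2)
   (no small parameter at the n.n. point), not the truth value; `LongRangeTrivialityOnZ3`, `EmbeddingModulusUniqueness`,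
   `ScaleCovarianceNotMoebius`, `LiouvilleRigidity` concern isotropy / inversion, not plane order. `ledger negatives`:
   nothing on plane defects.
7. LITERATURE NEGATIVES: `lit search '"defect plane" Ising'` (local: KrishnanMetlitski2023, Pleimling2004
   arXiv:cond-mat/0402574, arXiv:2411.16522; remote: BurkhardtEisenriegler1981 PRB 24 1236, Iglói 1989 PRB 40 5187
   (2D, non-universal = marginal, item 3), Benyoussef–El Kenz 1993 PRB 47 2619 (wetting at a defect plane)) — no claim of
   `J* = 0` or of a first-order plane transition in `d = 3`.
8. SMALL MODELS: exact enumeration is useless (LRO is an infinite-volume property of a 3D critical system); the Monte-Carlo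
   `J`-scan of the typed twin (§6, kit j026694) shows ONE smooth threshold at `J* = 1.0 ± 0.15` — nothing to attack.

## §4 Line `seam_renewal` — stub-by-stub (lead prover-line-stmt-CriticalPhenomena-16906-0; 6 stubs: 4 LANDED, 2 OPEN; no stub refuted)

Status at 2026-08-17T15:35Z (skeleton header): LANDED (M) `stub_seamMonotone` p166260, (S) `stub_strongSeamOrder` p168573
(`J₀ = 2/β_c(3)`; decoration–iteration to the free planar model at `½ log cosh 4 > β_c(2)`), (W2)
`stub_planeSummable_of_surfaceSummable` p169014 (+ p168704, p168794, p168894 — the typing gap flagged in cycle 1, half-crystal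
index type vs couplings zeroed outside `B`, is closed by the lead's renewal-states file), (C′)
`stub_noOrderAtOnset_of_bubbleIntegrable` p167917. OPEN: (W1) `stub_surfaceSummable`, (C2) `stub_bubbleIntegrable`; the glue is
now `TwinThreshold_of : (W1) → (C2) → ReflectionTwin.TwinThreshold` (kernel-checked). The line therefore stands or falls with
two statements that are physically true and rigorously open; neither is attackable by models or numerics (§3, §6).

* (M) — LANDED. Guard `0 ≤ J` load-bearing (§2; `no_threshold_of_seamMonotone_unguarded`, p167349).
* (S) — LANDED (free-state order handled exactly as the typing trap of cycle 1 required: free = plus planar two-point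
  function above `β_c(2)` on a decorated sublattice inside the free twin boxes).
* (W1) `stub_surfaceSummable` — OPEN, physically TRUE: surface two-point function of the critical half-crystal along the
  free (111) surface `~ r^{-2Δ̂_ord}`, `2Δ̂_ord = 2.55 > 2 = dim`, i.e. `γ₁₁ = ν(d-1-2Δ̂_ord) ≈ -0.35 < 0` (margin `0.28` in `Δ̂`);
  refuting it = `Δ̂_ord ≤ 1`, no engine either way. Mutations: uniformity in `v` automatic (in-plane homogeneity of `H⁻`);
  the restriction of `F` to the surface LAYER is load-bearing (over all of `H⁻` the sum is `χ₁`, `γ₁ = ν(2-η_⊥) > 0`,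
  divergent) — true divergence, but not provable from the tree (no lower bounds on half-space correlations at `β_c`).
* (W2) — LANDED.
* (C2) `stub_bubbleIntegrable` — OPEN, physically TRUE, and with MORE margin than cycle 1 recorded. GUARDS: both load-bearing,
  now THEOREMS (p169504, `Theorems/TwinThreshold/Negative/TwinThresholdBubbleGuards.lean`, sorry-free, from landed (S) +
  `stub_twinBoxMonotone` + the plane gauge): `stub_bubbleIntegrable_false_without_disorderGuard` (delete `J < J'' → ¬ LRO J''`:
  at the ordered `J₀ > 0` of (S) the thick-plane bubble at base point `0` is unbounded over boxes — `N` diagonal plane sites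
  `(n,-n,0)` each exceed `m/2` in one common box) and `stub_bubbleIntegrable_false_without_nonnegGuard` (delete `0 ≤ J`:
  `-J₀ < 0 = J''` is below a DISORDERED coupling, and plane–plane box correlators are even in `J`, so the bubble at `-J₀`
  is unbounded too — (C2), like (M), is a statement about `J ≥ 0` only). MARGIN, recomputed: `Bf` need only be locally
  integrable, so an integrable BLOW-UP of the box-uniform bubble `B(J) := sup_{L,x} ∑_thick ⟨σ_xσ_u⟩²` as `J ↑ J*` is allowed
  ((C2) ⟺ `B(J) < ∞` on `[0,J*)` and `∫₀^{J*} B < ∞`, `B` being monotone). With the crossover length `ξ(J) ~ (J*-J)^{-1/y}`,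
  `1/y = 1/(2-Δ_ε) = 1.70`, and onset decay `r^{-2Δ̂_onset}` inside `ξ`: `B(J) ~ ξ^{max(0, 2-4Δ̂_onset)}` (`log ξ` at equality), so
  (C2) ⟸ `(2-4Δ̂_onset)/y < 1` ⟺ `Δ̂_onset > (2-y)/4 = 0.353`. At the transparent onset `Δ̂_onset = Δ_σ = 0.518`: margin `0.165`
  in `Δ̂` — NOT the `2η = 0.073` of cycle 1 (that was the margin for a BOUNDED bubble at `J*`; even `η = 0` exactly gives
  `B ~ 1.70·log(1/(J*-J))`, integrable). What (C2) really needs: (i) square-summability of the plane two-point function at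
  every `J < J*` UNIFORMLY IN BOXES (the `Ord × Ord` decay; (W1)+(W2) give it only on `(0, J₀]`, the window `(J₀, J*)` is the
  open core) and (ii) at most an integrable singularity at `J*`. The infrared bound `G ≤ C‖x‖⁻¹` alone gives `B_L ≤ C² log L`,
  uniform in `J` but not in `L` — still insufficient for (i). If `J* = 0`, (C2) is vacuous on `J ≥ 0` — consistent, no leak.
  THICK-PLANE restriction `h u ∈ {-1,0,1}`: LOAD-BEARING at the physics level after all (cycle 1 called it 'possibly
  unnecessary', looking only at fixed `J < J*`, where plane-to-bulk `⟨σ₀σ_u⟩² ~ r^{-2(Δ̂_ord+Δ_σ)} = r^{-3.59}` is summable over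
  `ℤ³`): near the onset the FULL bubble `∑_{u ∈ ℤ³} ⟨σ₀σ_u⟩²` collects `ξ^{3-4Δ_σ} = ξ^{0.93}` from the crossover ball, and
  `(3-4Δ_σ)/y = 1.58 > 1` is a NON-integrable divergence in `J`; (C′) rightly needs only the thick plane (all `J`-bonds live
  there, and Cauchy–Schwarz over the `≤ 6` bonds per thick site closes on thick bubbles).
* (C′) — LANDED (derivative bookkeeping as re-derived in cycle 1: `≤ 6β_c ∫ Bf`).
* JOINT SUFFICIENCY: `TwinThreshold_of : (W1) → (C2) → TwinThreshold` kernel-checked by the lead; partial exactness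
  (crux ⇒ (S) ∧ (W-conclusion)) too. No gap is smuggled: (W1)+(W2) ⇒ `¬ LRO J₀` for some `J₀ > 0`; (M)+(S) ⇒ a threshold
  `J* ≥ J₀`; (C2)+(C′) ⇒ `¬ LRO J*`.
-/

/-! ## §5 Near-misses — parameter variants that WOULD be false (the only `sorry`s of this file) -/

section NearMisses

/-- The crux with the bulk inverse temperature `β` as a PARAMETER (the crux is `TwinThresholdAt (criticalBeta 3)`,
`twinThresholdAt_criticalBeta`). [folklore] -/
def TwinThresholdAt (β : ℝ) : Prop :=
  let twinLatβ : ℝ → (k : ℕ) → (Fin k → Site 3) → ℝ := fun J k z => ⨆ L : ℕ, PairIsing.gibbsAvg (fun a b : ↥(box 3 L) => if (((∑ i, |a.1 i - b.1 i| = 1) ∧ ¬ ((a.1 0 + a.1 1 + a.1 2 = 0 ∧ b.1 0 + b.1 1 + b.1 2 = 1) ∨ (a.1 0 + a.1 1 + a.1 2 = 1 ∧ b.1 0 + b.1 1 + b.1 2 = 0))) ∨ (((a.1 0 + a.1 1 + a.1 2 = 0 ∧ b.1 0 + b.1 1 + b.1 2 = 1) ∨ (a.1 0 + a.1 1 + a.1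 2 = 1 ∧ b.1 0 + b.1 1 + b.1 2 = 0)) ∧ ∃ i : Fin 3, a.1 + b.1 = Pi.single i 1)) then (β / 2) * (if a.1 0 + a.1 1 + a.1 2 = 0 ∨ b.1 0 + b.1 1 + b.1 2 = 0 then J else 1) else 0) (obsC L k z)
  let lroβ : ℝ → Prop := fun J => ∃ m : ℝ, 0 < m ∧ ∀ c : Site 3, c 0 + c 1 + c 2 = 0 → m ≤ twinLatβ J 2 ![0, c]
  ∃ J : ℝ, 0 < J ∧ ¬ lroβ J ∧ ∀ J' : ℝ, J < J' → lroβ J'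

/-- The crux is the parametrised statement at `β_c(3)` (pure unfolding). [folklore] -/
theorem twinThresholdAt_criticalBeta : TwinThresholdAt (criticalBeta 3) ↔ ReflectionTwin.TwinThreshold := Iff.rfl

/-- NEAR-MISS N1 — **bulk (sub)criticality is load-bearing: in the ORDERED bulk the threshold degenerates to `J* = 0`.**
For `β > β_c(3)` and every `J > 0`: keep only the bond `{0, -e₀}`, the bond `{c, c - e₀}` and the half-crystal `H⁻`
(Griffiths II); dangling bonds factor, `⟨σ₀σ_c⟩_{TW_β(J)} ≥ tanh²(βJ) · ⟨σ_{-e₀} σ_{c-e₀}⟩^{free}_{H⁻, β} ≥ tanh²(βJ) · m₁(β)² > 0`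
with `m₁(β) > 0` the surface spontaneous magnetisation of the half-crystal (Fröhlich–Pfister 1987: the free (111) surface
orders exactly when the bulk does). So `LRO J` for all `J > 0`, `¬ LRO 0`, and no `J > 0` is a threshold. OBSTRUCTION to
closing it here: the tree has no surface-order theorem for a half-space at `β > β_c(3)` (nor free = plus for even
correlations on `H⁻`); with it, N1 is an afternoon. [cite: FrohlichPfister1987II, surface order iff bulk order] -/
theorem not_twinThresholdAt_of_supercritical {β : ℝ} (hβ : criticalBeta 3 < β) : ¬ TwinThresholdAt β := by
  sorry

/-- All-sites long-range order (drop the restriction `c₀+c₁+c₂ = 0` of the crux's `LRO`). [folklore] -/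
def lroAllC (J : ℝ) : Prop := ∃ m : ℝ, 0 < m ∧ ∀ c : Site 3, m ≤ twinLatC J 2 ![0, c]

/-- NEAR-MISS N2 — **the plane restriction in `LRO` is load-bearing: NO coupling has all-sites order at bulk `β_c(3)`.**
For every `J ≥ 0` and `c` at distance `R` below the thick plane: raise every coupling inside the thick plane
`{h ∈ {-1,0,1}}` to `+∞` (Griffiths II: `⟨σ₀σ_c⟩` increases); the thick plane freezes into one spin `S` and
`⟨σ₀σ_c⟩ ≤ ⟨S σ_c⟩ = ⟨σ_c⟩^{+}` in the region below with plus boundary condition on the frozen layer, which is at most the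
plus-box magnetisation `⟨σ_c⟩^{+}_{Λ_R(c), β_c}` (domain monotonicity of the plus state), and that tends to
`m*(β_c(3)) = 0` (`spontaneousMagnetization_criticalBeta_eq_zero_holds`, ADCS 2015). Hence `inf_c twinLat J 2 ![0,c] = 0`
for every `J`, `lroAllC J` never holds, and the all-sites threshold statement is false. OBSTRUCTION: the `J → ∞`
gluing-equals-plus-boundary comparison and plus-state domain monotonicity are not available for `PairIsing` boxes in the
tree (size L plumbing, no new idea). [cite: AizenmanDuminilCopinSidoraviciusCMP2015, Thm. 1.1] -/
theorem not_exists_allSites_threshold : ¬ ∃ J : ℝ, 0 < J ∧ ¬ lroAllC J ∧ ∀ J' : ℝ, J < J' → lroAllC J' := by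
  sorry

end NearMisses

/-! ## §6 Numerics — MC `J`-scan of the typed twin (kit job `j026694`, done 2026-08-17, 4 cores × 21 min)

MODEL = EXACTLY the crux's finite-volume twin: free boxes `{-L..L}³`, `L = 5, 8, 11` (plane `h = 0` has
`N_C = 3L²+3L+1 = 91, 217, 397` sites); bonds = n.n. bonds of `ℤ³` minus those between the layers `h = 0` and `h = 1`, plus
the seam bonds `{c, e_i - c}` (`h c = 0`); weight `J` on the `6` bonds at each plane site, `1` elsewhere; `β = 0.221654626`.
Checkerboard (parity of `h`) heat-bath, `7.2·10⁵ / 3.0·10⁵ / 1.2·10⁵` sweeps (10 % thermalisation), jackknife errors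
(script `mc/main.py` of the disprover folder; raw rows `~/compute/j026694/outputs/results.json`, summary attached to the item).
Columns: plane Binder cumulant `U₄ = 1 - ⟨M⁴⟩/3⟨M²⟩²` over ALL plane sites / over the CENTRAL ones (`‖z‖_∞ ≤ L/2`);
`χ_C = N_C⟨M²⟩`; the free-box correlator `G_L(0,c_L)` to the FARTHEST plane site `c_L = (L,-L,0)` — a lower bound for the
crux's `twinLat J 2 ![0,c_L] = sup_L' G_L'(0,c_L)`. Entries are `L = 5 / 8 / 11`; `U₄` errors ≤ `.003 / .007 / .017`.

   J     U₄ plane            U₄ central          χ_C                  G_L(0,(L,-L,0))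
  0.00  .007/.004/.009      .032/.010/.008      1.00/1.00/1.01       −.001/−.001/ .000
  0.30  .011/.005/.005      .042/.011/.012      1.10/1.11/1.12        .000/ .002/ .005
  0.60  .017/.017/.005      .064/.030/.013      1.48/1.59/1.68        .002/ .001/ .004
  0.80  .039/.020/.024      .109/.056/.055      2.11/2.49/2.76       −.001/−.002/−.002
  0.90  .056/.045/.031      .150/.101/.088      2.70/3.39/3.91        .004/ .003/−.001
  1.00  .092/.087/.090      .199/.158/.169      3.63/5.10/6.87        .006/ .006/ .005
  1.10  .157/.162/.171      .271/.255/.269      5.27/9.04/13.0        .017/ .009/ .010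
  1.20  .256/.324/.394      .360/.405/.466      8.40/18.7/36.6        .035/ .025/ .023
  1.35  .434/.558/.620      .503/.592/.634      18.0/57.9/137         .111/ .123/ .135
  1.50  .570/.641/.659      .601/.649/.659      35.1/112 /233         .260/ .297/ .299
  1.75  .649/.663/.665      .655/.663/.665      62.7/167 /319         .532/ .544/ .542
  2.00  .662/.665/.666      .663/.665/.666      76.7/192 /359         .714/ .716/ .724

READING (numbers, then the one-line consequence for the crux):
1. ONE THRESHOLD, `J* = 1.0 ± 0.15`. Binder crossings (linear interpolation between scan points): plane `(5,8) 1.05`,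
   `(8,11) 0.99`, `(5,11) 1.01`; central `(5,8) 1.13`, `(8,11) 0.95`, `(5,11) 1.10` (each `± 0.1`: at `J = 1.0, 1.1` the
   `L = 8` vs `11` differences are `0.002 ± 0.010`, `0.009 ± 0.017`, i.e. noise; the `(5,8)` pair separates only at
   `J = 0.9` (`-0.011 ± 0.005`) and `J = 1.2` (`+0.068`)). Below it `U₄ → 0` with `L` (`J ≤ 0.9`), above it `U₄ ↑ 2/3`
   (`J ≥ 1.2`). ⇒ the `LRO`-set looks like a half-line with a finite positive endpoint, as the crux says.
2. `J* > 0` (the (W) half): `χ_C` saturates in `L` for `J ≤ 0.9` — effective exponents `d log χ_C / d log L` on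
   `(5→8, 8→11)`: `.03,.03` (`J=.3`), `.15,.18` (`.6`), `.35,.32` (`.8`), `.49,.44` (`.9`) against `.72,.94` (`1.0`),
   `1.15,1.15` (`1.1`), `1.7,2.1` (`1.2`) and `→ 2` (`= LRO`) from `J = 1.5` on. Consistent with summable plane correlations
   below `J*` (`2Δ̂ > 2`); `L ≤ 11` cannot separate saturation from a small power, so this is corroboration, not evidence
   of the exponent.
3. `LRO` IN THE CRUX'S OWN CURRENCY: `G_L(0,c_L) ≥ 0.11` and NON-DECREASING in `L` for every `J ≥ 1.35` (free boxes, farthest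
   plane site) — a direct finite-volume lower bound of `inf_c sup_L ⟨σ₀σ_c⟩`; `≤ 0.006 ≈ noise` for `J ≤ 1.0`.
4. NO FIRST-ORDER SIGNATURE: at each `L`, `U₄` and `⟨M²⟩` are smooth and monotone in `J`, `U₄ > 0` throughout (no negative
   dip), single crossing. A weak first-order onset is not excludable at `L ≤ 11`, but nothing hints at one (theory, §3.5:
   one relevant even coupling, continuous onset; and the crux's free-state `¬ LRO J*` would survive a Potts-like jump anyway).
5. THE UNTUNED TWIN `J = 1` SITS AT THE THRESHOLD WITHIN RESOLUTION (`U₄` plane `.092(2)/.087(5)/.090(9)`, flat in `L`).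
   This is forced, and NO feasible simulation resolves the sign of `J* - 1` by finite-size scaling: the twin is an
   extremely weak even defect. Size of the defect: the route file's CHEAPEST FALSIFIER (ii) (closed-walk counts from a plane
   site agree with `ℤ³` through length 8 — `6, 90, 1860, 44730` —, rooted 8-cycles `3288` vs `3312`) and the crux idea card
   `Ideas/twisted-double-domination.md` (r1.3): the plane two-point HT series of `TW(1)` and of `ℤ³` AGREE THROUGH ORDER `t¹⁰`
   and first differ at `t¹²` (plane-summed coefficient `+144 t¹²`, `t = tanh β_c ≈ 0.218`, i.e. `~10⁻⁶`), while the
   Cauchy–Schwarz gap of the would-be domination `TW ≤ Z3` is `O(t⁸) ~ 10⁻⁵` per site. Hence the effective even plane coupling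
   is `|g₀| ~ 10⁻⁶…10⁻⁵`, the crossover length `ℓ× ≈ |g₀|^{-1/y}`, `1/y = 1/(2-Δ_ε) = 1.70`, is `~10⁸…10¹⁰` lattice units, and
   `|J* - 1|` is of order `g₀`, i.e. `~10⁻⁵`: no box that fits in a computer distinguishes `TW(1)` from transparent, and my
   scan (`L ≤ 11`) is consistent with either sign, as it must be. THE SIGN ITSELF IS OPEN: the infinite-lattice leading
   correction (`+144 t¹²`, plane sum ENHANCED) points to a marginally ordering defect (`J* = 1 - O(10⁻⁶)`), whereas the
   ideator's finite free cubes (exact `3³` enumeration, kit j025543; `L = 6` scan, kit j025508) show the plane two-point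
   function of `TW(1)` BELOW that of `Z3(1)` by `10⁻⁶…10⁻⁴` — a boundary-dominated effect at those sizes, not the bulk sign.
   Immaterial for THIS crux (it needs some threshold, not its position relative to `1`); material only for reading the route's
   `J = 1` transparency numerics (they probe `ℓ ≪ ℓ×` and cannot tell transparent from weakly relevant of either sign) and
   for the `twisted-double-domination` card (`TW(J) ≤ Z3(J)` sitewise would force `J* ≥ 1`; the `+144 t¹²` sign is
   evidence AGAINST that domination holding exactly).
VERDICT OF §6: the numerics corroborate every clause of the crux (finite positive threshold, order above, disorder below,
continuous-looking onset); no attack surface found. No kill.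
-/

end Summit.CriticalPhenomena.Ising3DConformalLimit.Cruxes.TwinThreshold.Disproof

end
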